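import Mathlib
import Summits.Ventures.PercRepro2.SwOutSevDefs
import Summits.Ventures.PercRepro2.SwOutSevPieces
import Summits.Ventures.PercRepro2.SwOutSevData

/-!
# The inside connectivity of the arm sets of the data at the canonical base (blind cell
PercRepro2, night-4 g22, 2026-08-27; proofs/NIGHT4-G22.md §2)

At the canonical base `b = coreBaseOf ζ` of a core-kind `Q`-point, every u-arm set of the data
(`dataU_conn`: a u-arm by `harm_conn_red'`, an absorbed arm through its red dead edge by
`absArm_conn_red`), every piece of a mixed arm (`dataAh_conn`, by `piece_conn_red`) and every far
arm (`dataF_conn`) is red-connected to `h` inside itself with `h`: the connectivity fields of the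
several-arms base.  Each arm lies on one side; on the red side the base agrees with `ζ`, on the
blue side with `blue ζ` (`insideConfig_coreBaseOf_of_subset_red/blue`).
-/

namespace Summit.Ventures.PercRepro2

namespace MixedArms

open Hull LocRows BigBlock

variable {V : Type*} {E : Type*} [Fintype E] [DecidableEq E]

open scoped Classical

variable {ends : E → Sym2 V} {ρ : Type*} [Fintype ρ] {U : Set V} {ξ : Config E} {l h o u : V}
  {p : ρ → V}

section Conn

variable (hj : MixedJunctionR ends U h u p o) (hl : l ∉ U) {ζ : Config E}
  (hζ : ζ ∈ swOutSide ends l h o U ξ) (hk : CoreKind ends U h u ζ)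
include hj hl hζ hk

/-- **A u-arm set of the data is red-connected to `h` inside itself at the canonical base.** -/
theorem dataU_conn : ∀ j : (mixedDataR ends h u p ζ).ι, ∀ x ∈ (mixedDataR ends h u p ζ).U j,
      x ∈ cluster ends (insideConfig ends ((mixedDataR ends h u p ζ).U j ∪ {h})
        (coreBaseOf ends ζ h u)) h := by
  have hhu := hj.hne_hu
  have hdisj : ∀ x, x ∈ redExt ends h u ζ → x ∈ blueExt ends ζ h u → False :=
    fun x hxR hxB => redExt_disjoint_blueExt hl hj.hout hζ hk x hxR hxB
  have hnoRB : ∀ e x y, ends e = s(x, y) → x ∈ redExt ends h u ζ → y ∈ blueExt ends ζ h u →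
      False := fun e x y hxy hx hy => no_edge_redExt_blueExt hdisj hxy hx hy
  have hHU : extHull ends ζ h u ⊆ U := extHull_subset_of_coreKind hζ hk
  have hdisj' : ∀ x, x ∈ redExt ends h u (blue ζ) → x ∈ blueExt ends (blue ζ) h u → False := by
    intro x hxR hxB
    rw [redExt_blue] at hxR
    rw [blueExt_blue] at hxB
    exact hdisj x hxB hxR
  have hAP : ∀ r, armC ends h u ζ (p r) ∈ armsC ends h u ζ := armP_mem_armsC_R hj ζ
  have hpP : ∀ r, p r ∈ armC ends h u ζ (p r) := fun r => mem_armC_self (p r)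
  set d := mixedDataR ends h u p ζ with hd
  have hAbs : ∀ x : {x // x ∈ d.abs}, d.U (Sum.inr x) = armC ends h u ζ (p x.1.1) ∧
      ¬ DeadBlueR ends h u p ζ x.1.1 := by
    intro x
    obtain ⟨hx1, hx2⟩ := mem_absArmsR_iff.1 x.2
    exact ⟨hx2, hx1⟩
  rintro (⟨P, hP⟩ | ⟨x, hx⟩)
  · -- a u-arm: as in Theorem A_mix
    intro z hz
    have hPm := (mem_uArmsR_iff.1 hP).1
    have hPu : ∀ e y, ends e = s(u, y) → y ∈ P → ∃ e', ends e' = s(y, h) := by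
      intro e y hey hyP
      refine hj.hu_adj_h e y hey ?_
      intro r hyp
      exact armsC_disjoint hPm (hAP r) ((mem_uArmsR_iff.1 hP).2.1 r) y hyP (hyp ▸ hpP r)
    show z ∈ cluster ends (insideConfig ends (P ∪ {h}) (coreBaseOf ends ζ h u)) h
    rcases armsC_subset_side hnoRB hPm with hPR | hPB
    · rw [insideConfig_coreBaseOf_of_subset_red hPR (Or.inl rfl) hdisj]
      exact harm_conn_red' hdisj hPm hPR hPu z hz
    · rw [insideConfig_coreBaseOf_of_subset_blue hPB hj.hloop_h]
      have hP' : P ∈ armsC ends h u (blue ζ) := by rw [armsC_blue]; exact hPm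
      have hPR' : P ⊆ redExt ends h u (blue ζ) := by rw [redExt_blue]; exact hPB
      exact harm_conn_red' hdisj' hP' hPR' hPu z hz
  · -- an absorbed arm: through its red dead edge
    intro z hz
    obtain ⟨hx1, hx2⟩ := hAbs ⟨x, hx⟩
    set r := x.1 with hr
    rw [hx1] at hz ⊢
    -- a red dead edge at the base
    have hred : ∃ e y, ends e = s(p r, y) ∧ y ∈ AhOfR ends h u p ζ r ∧
        coreBaseOf ends ζ h u e = true := by
      by_contra hno
      apply hx2
      intro e y hey hy
      by_contra hne
      exact hno ⟨e, y, hey, hy, by simpa using hne⟩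
    obtain ⟨e₀, y₀, he₀, hy₀, hred₀⟩ := hred
    have hy₀H : y₀ ∈ extHull ends ζ h u := (armsC_subset (hAP r) y₀ hy₀.1).1
    have hy₀u : y₀ ≠ u := (armsC_subset (hAP r) y₀ hy₀.1).2.2
    obtain ⟨e₁, he₁⟩ := hj.hp_adj_h r e₀ y₀ he₀ (hHU hy₀H) hy₀u
    have hno_u : ∀ e y, ends e = s(u, y) → y ∈ armC ends h u ζ (p r) → y = p r :=
      fun e y hey hy => eq_p_of_u_edge_R hj hHU r hey hy
    show z ∈ cluster ends (insideConfig ends (armC ends h u ζ (p r) ∪ {h})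
      (coreBaseOf ends ζ h u)) h
    rcases armsC_subset_side hnoRB (hAP r) with hPR | hPB
    · rw [insideConfig_coreBaseOf_of_subset_red hPR (Or.inl rfl) hdisj]
      have hred₀' : ζ e₀ = true := by
        rw [← hred₀]
        exact (coreBaseOf_apply_of_notMem he₀ (fun h' => hdisj _ (hPR (hpP r)) h')
          (fun h' => hdisj _ (hPR hy₀.1) h')).symm
      have hred₁ : ζ e₁ = true := by
        by_contra hb
        simp only [Bool.not_eq_true] at hb
        have hb' : blue ζ e₁ = true := by rw [blue_eq_true_iff]; exact hb
        have hy₀B : y₀ ∈ blueExt ends ζ h u := by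
          rw [mem_blueExt_iff]
          exact ⟨Or.inl (mem_cluster_of_edge (mem_cluster_self _ _ _) hb' (ends_swap he₁)),
            (armsC_subset (hAP r) y₀ hy₀.1).2.1, hy₀u⟩
        exact hdisj y₀ (hPR hy₀.1) hy₀B
      exact absArm_conn_red (hAP r) hPR hno_u he₀ hy₀ hred₀' he₁ hred₁ z hz
    · rw [insideConfig_coreBaseOf_of_subset_blue hPB hj.hloop_h]
      have hAP' : armC ends h u (blue ζ) (p r) ∈ armsC ends h u (blue ζ) := by
        rw [armsC_blue, armC_eq_of_extHull_eq extHull_blue]; exact hAP r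
      have hPR' : armC ends h u (blue ζ) (p r) ⊆ redExt ends h u (blue ζ) := by
        rw [redExt_blue, armC_eq_of_extHull_eq extHull_blue]; exact hPB
      have hno_u' : ∀ e y, ends e = s(u, y) → y ∈ armC ends h u (blue ζ) (p r) → y = p r := by
        intro e y hey hy
        rw [armC_eq_of_extHull_eq extHull_blue] at hy
        exact hno_u e y hey hy
      have hy₀' : y₀ ∈ AhOfR ends h u p (blue ζ) r := by rw [AhOfR_blue]; exact hy₀
      have hred₀' : blue ζ e₀ = true := by
        rw [← hred₀, coreBaseOf_apply_of_mem he₀ (hPB (hpP r))]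
        rfl
      have hred₁ : blue ζ e₁ = true := by
        by_contra hb
        have hb' : ζ e₁ = true := by
          cases hc : ζ e₁ with
          | true => rfl
          | false => exact absurd (by rw [blue_eq_true_iff]; exact hc) hb
        have hy₀R : y₀ ∈ redExt ends h u ζ := by
          rw [mem_redExt_iff]
          exact ⟨Or.inl (mem_cluster_of_edge (mem_cluster_self _ _ _) hb' (ends_swap he₁)),
            (armsC_subset (hAP r) y₀ hy₀.1).2.1, hy₀u⟩
        exact hdisj y₀ hy₀R (hPB hy₀.1)
      have key := absArm_conn_red hAP' hPR' hno_u' he₀ hy₀' hred₀' he₁ hred₁ z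
        (by rw [armC_eq_of_extHull_eq extHull_blue]; exact hz)
      rw [armC_eq_of_extHull_eq extHull_blue] at key
      exact key

/-- **A piece of the data is red-connected to `h` inside itself at the canonical base.** -/
theorem dataAh_conn : ∀ i : (mixedDataR ends h u p ζ).ν, ∀ x ∈ (mixedDataR ends h u p ζ).Ah i,
      x ∈ cluster ends (insideConfig ends ((mixedDataR ends h u p ζ).Ah i ∪ {h})
        (coreBaseOf ends ζ h u)) h := by
  have hhu := hj.hne_hu
  have hdisj : ∀ x, x ∈ redExt ends h u ζ → x ∈ blueExt ends ζ h u → False :=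
    fun x hxR hxB => redExt_disjoint_blueExt hl hj.hout hζ hk x hxR hxB
  have hnoRB : ∀ e x y, ends e = s(x, y) → x ∈ redExt ends h u ζ → y ∈ blueExt ends ζ h u →
      False := fun e x y hxy hx hy => no_edge_redExt_blueExt hdisj hxy hx hy
  have hHU : extHull ends ζ h u ⊆ U := extHull_subset_of_coreKind hζ hk
  have hdisj' : ∀ x, x ∈ redExt ends h u (blue ζ) → x ∈ blueExt ends (blue ζ) h u → False := by
    intro x hxR hxB
    rw [redExt_blue] at hxR
    rw [blueExt_blue] at hxB
    exact hdisj x hxB hxR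
  have hAP : ∀ r, armC ends h u ζ (p r) ∈ armsC ends h u ζ := armP_mem_armsC_R hj ζ
  have hpP : ∀ r, p r ∈ armC ends h u ζ (p r) := fun r => mem_armC_self (p r)
  set d := mixedDataR ends h u p ζ with hd
  have hPc : ∀ i : d.ν, DeadBlueR ends h u p ζ i.1.1 ∧
      ∃ y ∈ AhOfR ends h u p ζ i.1.1, d.Ah i = pieceC ends h u p ζ i.1.1 y := by
    intro i
    exact exists_pieceC_of_mem_piecesR (Finset.mem_filter.1 i.2).1
  intro i z hz
  obtain ⟨hi, y, hy, hiy⟩ := hPc i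
  set r := i.1.1 with hr
  have hno_u : ∀ e x, ends e = s(u, x) → x ∈ armC ends h u ζ (p r) → x = p r :=
    fun e x hex hx => eq_p_of_u_edge_R hj hHU r hex hx
  rw [hiy] at hz ⊢
  show z ∈ cluster ends (insideConfig ends (pieceC ends h u p ζ r y ∪ {h})
    (coreBaseOf ends ζ h u)) h
  rcases armsC_subset_side hnoRB (hAP r) with hPR | hPB
  · have hsub : pieceC ends h u p ζ r y ⊆ redExt ends h u ζ :=
      fun v hv => hPR (pieceC_subset hy hv).1
    rw [insideConfig_coreBaseOf_of_subset_red hsub (Or.inl rfl) hdisj]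
    refine piece_conn_red (hAP r) hPR hno_u ?_ hy z hz
    intro e x hex hx
    rw [← hi e x hex hx]
    exact (coreBaseOf_apply_of_notMem hex (fun h' => hdisj _ (hPR (hpP r)) h')
      (fun h' => hdisj x (hPR hx.1) h')).symm
  · have hsub : pieceC ends h u p ζ r y ⊆ blueExt ends ζ h u :=
      fun v hv => hPB (pieceC_subset hy hv).1
    rw [insideConfig_coreBaseOf_of_subset_blue hsub hj.hloop_h]
    have hAP' : armC ends h u (blue ζ) (p r) ∈ armsC ends h u (blue ζ) := by
      rw [armsC_blue, armC_eq_of_extHull_eq extHull_blue]; exact hAP r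
    have hPR' : armC ends h u (blue ζ) (p r) ⊆ redExt ends h u (blue ζ) := by
      rw [redExt_blue, armC_eq_of_extHull_eq extHull_blue]; exact hPB
    have hno_u' : ∀ e x, ends e = s(u, x) → x ∈ armC ends h u (blue ζ) (p r) → x = p r := by
      intro e x hex hx
      rw [armC_eq_of_extHull_eq extHull_blue] at hx
      exact hno_u e x hex hx
    have hdead' : ∀ e x, ends e = s(p r, x) → x ∈ AhOfR ends h u p (blue ζ) r →
        blue ζ e = false := by
      intro e x hex hx
      rw [AhOfR_blue] at hx
      rw [← hi e x hex hx, coreBaseOf_apply_of_mem hex (hPB (hpP r))]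
      rfl
    have hy' : y ∈ AhOfR ends h u p (blue ζ) r := by rw [AhOfR_blue]; exact hy
    have key := piece_conn_red hAP' hPR' hno_u' hdead' hy' z (by rw [pieceC_blue]; exact hz)
    rw [pieceC_blue] at key
    exact key

/-- **A far arm of the data is red-connected to `h` inside itself at the canonical base.** -/
theorem dataF_conn : ∀ k : (mixedDataR ends h u p ζ).κ, ∀ x ∈ (mixedDataR ends h u p ζ).F k,
      x ∈ cluster ends (insideConfig ends ((mixedDataR ends h u p ζ).F k ∪ {h})
        (coreBaseOf ends ζ h u)) h := by
  have hhu := hj.hne_hu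
  have hdisj : ∀ x, x ∈ redExt ends h u ζ → x ∈ blueExt ends ζ h u → False :=
    fun x hxR hxB => redExt_disjoint_blueExt hl hj.hout hζ hk x hxR hxB
  have hnoRB : ∀ e x y, ends e = s(x, y) → x ∈ redExt ends h u ζ → y ∈ blueExt ends ζ h u →
      False := fun e x y hxy hx hy => no_edge_redExt_blueExt hdisj hxy hx hy
  have hHU : extHull ends ζ h u ⊆ U := extHull_subset_of_coreKind hζ hk
  have hdisj' : ∀ x, x ∈ redExt ends h u (blue ζ) → x ∈ blueExt ends (blue ζ) h u → False := by
    intro x hxR hxB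
    rw [redExt_blue] at hxR
    rw [blueExt_blue] at hxB
    exact hdisj x hxB hxR
  have hAP : ∀ r, armC ends h u ζ (p r) ∈ armsC ends h u ζ := armP_mem_armsC_R hj ζ
  have hpP : ∀ r, p r ∈ armC ends h u ζ (p r) := fun r => mem_armC_self (p r)
  set d := mixedDataR ends h u p ζ with hd
  have hFmem : ∀ k : d.κ, d.F k ∈ armsC ends h u ζ := fun k => dataF_mem_armsC k
  intro k z hz
  have hPm := hFmem k
  have hPu : ∀ e y, ends e = s(u, y) → y ∈ d.F k → ∃ e', ends e' = s(y, h) := by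
    intro e y hey hyP
    exact absurd ⟨e, y, hey, hyP⟩ (mem_farArmsR_iff.1 k.2).2.2
  show z ∈ cluster ends (insideConfig ends (d.F k ∪ {h}) (coreBaseOf ends ζ h u)) h
  rcases armsC_subset_side hnoRB hPm with hPR | hPB
  · rw [insideConfig_coreBaseOf_of_subset_red hPR (Or.inl rfl) hdisj]
    exact harm_conn_red' hdisj hPm hPR hPu z hz
  · rw [insideConfig_coreBaseOf_of_subset_blue hPB hj.hloop_h]
    have hP' : d.F k ∈ armsC ends h u (blue ζ) := by rw [armsC_blue]; exact hPm
    have hPR' : d.F k ⊆ redExt ends h u (blue ζ) := by rw [redExt_blue]; exact hPB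
    exact harm_conn_red' hdisj' hP' hPR' hPu z hz

end Conn

end MixedArms

end Summit.Ventures.PercRepro2
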